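import Summits.ResolutionOfSingularities.ResolutionOfSingularities.Theorems.PurelyInseparableDim4WinCertSubst
import Summits.ResolutionOfSingularities.ResolutionOfSingularities.Theorems.PurelyInseparableDim4ScopeBlindSubstCert
import HarnessLib
import HarnessLib.Audit.Tags

/-!
# Purely inseparable fourfolds — FCert v2 (`SCert`: flats AND substitution leaves): the row checker `swinCertBL` and its
# SOUNDNESS over EVERY field of characteristic `p` (in-scope game, `q = p`)
# [OURS · counted 0 · a certificate format for OUR frame v4, not about resolution]

Census cell «res-dim4-pi» (D-0157 DOOR 2), desk WORD #111 (b) (one-owner line: res-dim4-p-8 g3 owns the LEAF LEMMA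
`ScopeBlind.substBlindB` / `not_inCoordinateScope_step_map_of_substBlindB` (`…ScopeBlindSubstCert`, p683502); this seat
owns the ROW CHECKER and the certificates); seat res-rescue-typ-3 g9.  Sequel of `…WinCertSubst` (cover witnesses `SWit`,
leaves `SLeaf`, `scoverOKL`, `rational_or_onFlat_or_onLeaf`) and of res-rescue-typ-3 g8's `…WinCertFlatSound` (whose proof
skeleton is followed line by line).

* `SRow = IRow × List SWit × List Flat × List SLeaf`, `SCert = List SRow`.
* `srowOKL p q rest row`: a `.mono` BLIND row, or origin not `q`-fold, or a MOVE row — centre permissible; every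
  `k`-rational reply is harmless (`ireplyOK`: child certified later) OR on a listed flat OR on a listed leaf
  (`srepliesOKB`); every flat's base child occurs later as a `q`-fold non-blind move row avoiding the flat's free
  coordinates (`sflatsOKB`, `sbaseOK`); every leaf has complete tests and passes p-8's `substBlindB` on its chart
  (`sleavesOKB`); and every chart of the centre is COVERED (`scoversOKB` = `scoverOKL` per chart).
* `swinCertBL`, block form `swinCertBL2` / `swinCertBL_append_of` (one long certificate over several `decide`s).
* **`srowGood_of_srowOK`** / **`forall_inScopeStateWins_of_swinCertBL`**: for `T : SCert (ZMod p)` with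
  `swinCertBL p p T = true` and every field `K` of characteristic `p`, every row state `⊗ K` is IN-SCOPE ESCAPABLE
  (`InScopeStateWins p`, B over all of `K⁴`).  The one new case w.r.t. `…WinCertFlatSound`: a `K`-edge `(j, b)` with `b`
  on a leaf `ℓ` of chart `j` leads to a child OUT of coordinate scope (`not_inCoordinateScope_step_map_of_substBlindB`),
  which A wins by default (`inScopeStateWins_of_not_inCoordinateScope`).
Nothing here proves resolution of singularities in dimension ≥ 4 / characteristic `p`; F4-C(2,2) stays OPEN; the column
this feeds certifies `InScopeStateWins` on listed roots only.  Counted 0; AI work, weaker than expert review.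
bears_on: LADDER-RESOLUTION:D157-DOOR2 (res-dim4-pi · F4-C ∀K column · FCert v2 soundness).
Supports stmt-ResolutionOfSingularities-16155 (helper).
-/

set_option linter.dupNamespace false

noncomputable section
open MvPolynomial Finset
open scoped BigOperators
namespace Summit.ResolutionOfSingularities.ResolutionOfSingularities.Theorems.PIDim4

namespace WinCertSubst

open Literature.AlgebraicGeometry.Resolution
open Literature.AlgebraicGeometry.Resolution.CentreBlowup
open StepKit WinCertSound InScopeWinCert ScopeCover ScopeBlind WinCertAllFields FlatAbsorb WinCertFlat

/-! ## 0. Rows and the kernel-reducible checker -/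

section Checker

variable {k : Type} [Field k] [DecidableEq k]

/-- A row of FCert v2: `(presented state, A's centre, blindness certificate?)`, cover witnesses, flats, leaves.
[folklore] -/
abbrev SRow (k : Type) : Type := IRow k × List (SWit k) × List (Flat k) × List (SLeaf k)

/-- A certificate: rows, children LATER in the list. [folklore] -/
abbrev SCert (k : Type) : Type := List (SRow k)

/-- A `.mono` blindness certificate of the row passes. [folklore] -/
def smonoBlindOK (q : ℕ) (row : SRow k) : Bool :=
  match row.1.2.2 with
  | some (.mono c w α₀ a) => blindB q row.1.1 c w α₀ a
  | _ => false

/-- **Kernel-reducible on-leaf test** for a `k`-rational point (`…WinCertSubst.onLeafB` evaluates an `MvPolynomial`,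
which `decide` cannot reduce; this variant evaluates the term lists with `ScopeBlind.evalAtL`). [folklore] -/
def onLeafBL (ℓ : SLeaf k) (b : Fin 4 → k) : Bool := decide (∀ i : Fin 4, evalAtL b (ℓ.σ i) = b i)

/-- A `k`-rational point passing `onLeafBL` is on the leaf over `K`. [folklore] -/
theorem onLeaf_of_onLeafBL {K : Type} [Field K] (f : k →+* K) {ℓ : SLeaf k} {b₀ : Fin 4 → k}
    (h : onLeafBL ℓ b₀ = true) : OnLeaf f ℓ (f ∘ b₀) := by
  classical
  refine onLeaf_of_onLeafB f (ℓ := ℓ) ?_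
  unfold onLeafB
  rw [decide_eq_true_eq]
  intro i
  have hi := of_decide_eq_true h i
  rw [← eval_evalT] at hi
  exact hi

variable [Fintype k]

/-- **The base child of a flat is certified later by a MOVE avoiding the flat's free coordinates.** [folklore] -/
def sbaseOK (q : ℕ) (rest : SCert k) (c : SData 4 k) (U : Finset (Fin 4)) : Bool :=
  rest.any fun r : SRow k => c.equivB r.1.1 && decide (r.1.2.2 = none) && permB q Finset.univ r.1.1.L &&
    permB q r.1.2.1 r.1.1.L && decide (Disjoint r.1.2.1 U)

/-- **Every `k`-rational reply is harmless, or on a flat, or on a leaf.** [folklore] -/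
def srepliesOKB (q : ℕ) (rest : SCert k) (s : SData 4 k) (S : Finset (Fin 4)) (flats : List (Flat k))
    (leaves : List (SLeaf k)) : Bool :=
  decide (∀ j ∈ S, ∀ b : Fin 4 → k, b j = 0 →
    ireplyOK q (rest.map fun r : SRow k => r.1) s S j b = true ∨
      (∃ φ ∈ flats, φ.j = j ∧ onFlatB φ b = true) ∨ (∃ ℓ ∈ leaves, ℓ.j = j ∧ onLeafBL ℓ b = true))

/-- **Every flat sits in a chart of the centre, through a centre point, with its base child certified later.**
[folklore] -/
def sflatsOKB (q : ℕ) (rest : SCert k) (s : SData 4 k) (S : Finset (Fin 4)) (flats : List (Flat k)) : Bool :=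
  decide (∀ φ ∈ flats, φ.j ∈ S ∧ φ.b0 φ.j = 0 ∧ sbaseOK q rest (stepD q S φ.j φ.b0 s) φ.U = true)

/-- **Every leaf sits in a chart of the centre, has complete tests, and passes `substBlindB` on that chart.**
[folklore] -/
def sleavesOKB (q : ℕ) (s : SData 4 k) (S : Finset (Fin 4)) (leaves : List (SLeaf k)) : Bool :=
  decide (∀ ℓ ∈ leaves, ℓ.j ∈ S ∧ testsOKB ℓ = true ∧ substBlindB q (chartL q S ℓ.j s.L) ℓ.σ ℓ.T ℓ.α₀ = true)

/-- **Every chart of the centre is covered.** [folklore] -/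
def scoversOKB (p q : ℕ) (s : SData 4 k) (S : Finset (Fin 4)) (wits : List (SWit k)) (flats : List (Flat k))
    (leaves : List (SLeaf k)) : Bool :=
  decide (∀ j ∈ S, scoverOKL p q s S j wits flats leaves = true)

/-- **The row check** of FCert v2. [folklore] -/
def srowOKL (p q : ℕ) (rest : SCert k) (row : SRow k) : Bool :=
  smonoBlindOK q row || !(permB q Finset.univ row.1.1.L) ||
    (permB q row.1.2.1 row.1.1.L &&
      srepliesOKB q rest row.1.1 row.1.2.1 row.2.2.1 row.2.2.2 &&
      sflatsOKB q rest row.1.1 row.1.2.1 row.2.2.1 &&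
      sleavesOKB q row.1.1 row.1.2.1 row.2.2.2 &&
      scoversOKB p q row.1.1 row.1.2.1 row.2.1 row.2.2.1 row.2.2.2)

/-- **The checker** of FCert v2. [folklore] -/
def swinCertBL (p q : ℕ) : SCert k → Bool
  | [] => true
  | row :: rest => srowOKL p q rest row && swinCertBL p q rest

/-- **Block form of the checker**: the rows of `A` are checked against their tails inside `A ++ B`; `B` itself is not
checked. [folklore] -/
def swinCertBL2 (p q : ℕ) : SCert k → SCert k → Bool
  | [], _ => true
  | row :: A, B => srowOKL p q (A ++ B) row && swinCertBL2 p q A B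

/-- `swinCertBL (A ++ B)` splits into the block check of `A` over `B` and the check of `B`. [folklore] -/
theorem swinCertBL_append (p q : ℕ) : ∀ A B : SCert k,
    swinCertBL p q (A ++ B) = (swinCertBL2 p q A B && swinCertBL p q B)
  | [], B => by simp [swinCertBL2]
  | row :: A, B => by
    rw [List.cons_append, show swinCertBL p q (row :: (A ++ B)) = (srowOKL p q (A ++ B) row && swinCertBL p q (A ++ B))
      from rfl, show swinCertBL2 p q (row :: A) B = (srowOKL p q (A ++ B) row && swinCertBL2 p q A B) from rfl,
      swinCertBL_append p q A B, Bool.and_assoc]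

/-- Assembling a certificate check from a block check and the check of the tail. [folklore] -/
theorem swinCertBL_append_of (p q : ℕ) {A B : SCert k} (hA : swinCertBL2 p q A B = true)
    (hB : swinCertBL p q B = true) : swinCertBL p q (A ++ B) = true := by
  rw [swinCertBL_append, hA, hB, Bool.and_self]

omit [Fintype k] in
/-- Soundness of `sbaseOK`. [folklore] -/
theorem exists_of_sbaseOK {q : ℕ} {rest : SCert k} {c : SData 4 k} {U : Finset (Fin 4)}
    (h : sbaseOK q rest c U = true) :
    ∃ r ∈ rest, c.toState = r.1.1.toState ∧ r.1.2.2 = none ∧ permB q Finset.univ r.1.1.L = true ∧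
      permB q r.1.2.1 r.1.1.L = true ∧ Disjoint r.1.2.1 U := by
  unfold sbaseOK at h
  obtain ⟨r, hr, hrc⟩ := List.any_eq_true.mp h
  simp only [Bool.and_eq_true, decide_eq_true_eq] at hrc
  obtain ⟨⟨⟨⟨he, hn⟩, hu⟩, hp⟩, hd⟩ := hrc
  exact ⟨r, hr, (toState_eq_iff c r.1.1).mpr he, hn, hu, hp, hd⟩

end Checker

/-! ## 1. The inductive invariant -/

/-- The state of a row, base-changed along `f`. [folklore] -/
def srowState {p : ℕ} [Fact p.Prime] {K : Type} [Field K] (f : ZMod p →+* K) (row : SRow (ZMod p)) : State K :=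
  ⟨MvPolynomial.map f row.1.1.toState.F, row.1.1.toState.r, row.1.1.toState.exc⟩

/-- **A good row** over `K`: its state is in-scope escapable, and — if it is a non-blind `p`-fold row — its centre is
permissible and every `K`-edge through its centre leads to an in-scope escapable state. [folklore] -/
def SRowGood {p : ℕ} [Fact p.Prime] {K : Type} [Field K] [DecidableEq K] (f : ZMod p →+* K)
    (row : SRow (ZMod p)) : Prop :=
  InScopeStateWins p (srowState f row) ∧
    (row.1.2.2 = none → permB p Finset.univ row.1.1.L = true →
      IsPermissibleCentre p row.1.2.1 (srowState f row).F ∧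
        ∀ t, Edge p row.1.2.1 (srowState f row) t → InScopeStateWins p t)

/-! ## 2. Soundness of one row -/

/-- The edges through the centre of a MOVE row all lead to in-scope escapable states. [folklore] -/
theorem sedges_of_move {p : ℕ} [Fact p.Prime] {K : Type} [Field K] [CharP K p] [DecidableEq K]
    (f : ZMod p →+* K) {rest : SCert (ZMod p)} (hrest : ∀ r ∈ rest, SRowGood f r) {row : SRow (ZMod p)}
    (hall : srepliesOKB p rest row.1.1 row.1.2.1 row.2.2.1 row.2.2.2 = true)
    (hflats : sflatsOKB p rest row.1.1 row.1.2.1 row.2.2.1 = true)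
    (hleaves : sleavesOKB p row.1.1 row.1.2.1 row.2.2.2 = true)
    (hcov : scoversOKB p p row.1.1 row.1.2.1 row.2.1 row.2.2.1 row.2.2.2 = true) :
    ∀ t, Edge p row.1.2.1 (srowState f row) t → InScopeStateWins p t := by
  classical
  unfold srepliesOKB at hall
  unfold sflatsOKB at hflats
  unfold sleavesOKB at hleaves
  unfold scoversOKB at hcov
  have hall' := of_decide_eq_true hall
  have hflats' := of_decide_eq_true hflats
  have hleaves' := of_decide_eq_true hleaves
  have hcov' := of_decide_eq_true hcov
  -- a flat of chart `j` absorbs every `K`-point on it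
  have hflat : ∀ (j : Fin 4) (φ : Flat (ZMod p)), φ ∈ row.2.2.1 → φ.j = j → ∀ b : Fin 4 → K, OnFlat f φ b →
      InScopeStateWins p (step p row.1.2.1 j b (srowState f row)) := by
    intro j φ hφ hφj b hb
    obtain ⟨-, -, hbase⟩ := hflats' φ hφ
    obtain ⟨r, hr, hrc, hnone, huniv, hpermr, hdisj⟩ := exists_of_sbaseOK hbase
    obtain ⟨v, hv, rfl⟩ := exists_add_of_onFlat f hb
    have hgood := (hrest r hr).2 hnone huniv
    have hstep : step p row.1.2.1 j (f ∘ φ.b0) (srowState f row) =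
        ⟨MvPolynomial.map f (stepD p row.1.2.1 φ.j φ.b0 row.1.1).toState.F,
          (stepD p row.1.2.1 φ.j φ.b0 row.1.1).toState.r, (stepD p row.1.2.1 φ.j φ.b0 row.1.1).toState.exc⟩ := by
      rw [srowState, ← hφj, BaseChange.step_map f p row.1.2.1 φ.j φ.b0 row.1.1.toState, step_toState]
    have hF : (step p row.1.2.1 j (f ∘ φ.b0) (srowState f row)).F = (srowState f r).F := by
      rw [hstep, srowState, hrc]
    refine inScopeStateWins_step_add_of_move (S' := r.1.2.1) (fun i hi => hv i ?_) ?_ ?_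
    · exact fun hiU => (Finset.disjoint_left.mp hdisj) hi hiU
    · rw [hF]; exact hgood.1
    · intro t ht
      obtain ⟨t', ht', hFt⟩ := edge_congr hF ht
      exact inScopeStateWins_congr (hgood.2 t' ht') t hFt
  -- a leaf of chart `j` gives a blind child at every `K`-point on it
  have hleaf : ∀ (j : Fin 4) (ℓ : SLeaf (ZMod p)), ℓ ∈ row.2.2.2 → ℓ.j = j → ∀ b : Fin 4 → K, OnLeaf f ℓ b →
      InScopeStateWins p (step p row.1.2.1 j b (srowState f row)) := by
    intro j ℓ hℓ hℓj b hb
    obtain ⟨-, -, hsub⟩ := hleaves' ℓ hℓ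
    refine inScopeStateWins_of_not_inCoordinateScope ?_
    rw [← hℓj]
    exact not_inCoordinateScope_step_map_of_substBlindB hsub K f b (eval_map_eq_of_onLeaf f hb)
  rintro s' ⟨j, b, hj, hbj, heq, hne, rfl⟩
  have h0 : ∀ φ : Flat (ZMod p), φ ∈ row.2.2.1 → φ.b0 φ.j = 0 := fun φ hφ => (hflats' φ hφ).2.1
  have ht : ∀ ℓ : SLeaf (ZMod p), ℓ ∈ row.2.2.2 → testsOKB ℓ = true := fun ℓ hℓ => (hleaves' ℓ hℓ).2.1
  rcases rational_or_onFlat_or_onLeaf f (hcov' j hj) h0 ht hbj heq with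
    ⟨b₀, hb₀j, rfl⟩ | ⟨φ, hφ, hφj, hon⟩ | ⟨ℓ, hℓ, hℓj, hon⟩
  · -- a rational reply
    rcases hall' j hj b₀ hb₀j with h | ⟨φ, hφ, hφj, honB⟩ | ⟨ℓ, hℓ, hℓj, honB⟩
    · have heq₀ : IsEquimultiplePoint p row.1.2.1 j b₀ row.1.1.toState :=
        (BaseChange.isEquimultiplePoint_map_ringHom_iff f p row.1.2.1 j b₀ row.1.1.toState).mp heq
      have hstep := BaseChange.step_map f p row.1.2.1 j b₀ row.1.1.toState
      unfold ireplyOK at h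
      rw [Bool.or_eq_true, Bool.or_eq_true] at h
      rcases h with (h1 | h2) | h3
      · rw [Bool.not_eq_true', ← Bool.not_eq_true] at h1
        exact absurd ((isEquimultiplePoint_iff p row.1.2.1 j b₀ row.1.1).mp heq₀) h1
      · exfalso
        apply hne
        show (step p row.1.2.1 j (f ∘ b₀) (srowState f row)).F = 0
        rw [srowState, hstep]
        show MvPolynomial.map f (step p row.1.2.1 j b₀ row.1.1.toState).F = 0
        have hz : (step p row.1.2.1 j b₀ row.1.1.toState).F = 0 := by
          by_contra hnz
          have := (step_F_ne_zero_iff p row.1.2.1 j b₀ row.1.1).mp hnz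
          rw [h2] at this
          exact Bool.noConfusion this
        rw [hz, map_zero]
      · obtain ⟨r, hr, hrc⟩ := exists_of_ichildIn h3
        obtain ⟨ur, hur, rfl⟩ := List.mem_map.mp hr
        show InScopeStateWins p (step p row.1.2.1 j (f ∘ b₀) (srowState f row))
        rw [srowState, hstep, step_toState, hrc]
        exact (hrest ur hur).1
    · exact hflat j φ hφ hφj _ (onFlat_of_onFlatB f honB)
    · exact hleaf j ℓ hℓ hℓj _ (onLeaf_of_onLeafBL f honB)
  · exact hflat j φ hφ hφj b hon
  · exact hleaf j ℓ hℓ hℓj b hon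

/-- **SOUNDNESS of one row over `K`.** [folklore] -/
theorem srowGood_of_srowOK {p : ℕ} [Fact p.Prime] {K : Type} [Field K] [CharP K p] [DecidableEq K]
    (f : ZMod p →+* K) {rest : SCert (ZMod p)} (hrest : ∀ r ∈ rest, SRowGood f r) {row : SRow (ZMod p)}
    (h : srowOKL p p rest row = true) : SRowGood f row := by
  classical
  unfold srowOKL at h
  rw [Bool.or_eq_true, Bool.or_eq_true] at h
  have hmove : permB p row.1.2.1 row.1.1.L = true →
      srepliesOKB p rest row.1.1 row.1.2.1 row.2.2.1 row.2.2.2 = true →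
      sflatsOKB p rest row.1.1 row.1.2.1 row.2.2.1 = true →
      sleavesOKB p row.1.1 row.1.2.1 row.2.2.2 = true →
      scoversOKB p p row.1.1 row.1.2.1 row.2.1 row.2.2.1 row.2.2.2 = true →
      IsPermissibleCentre p row.1.2.1 (srowState f row).F ∧
        ∀ t, Edge p row.1.2.1 (srowState f row) t → InScopeStateWins p t := by
    intro hS hall hflats hleaves hcov
    have hperm : IsPermissibleCentre p row.1.2.1 row.1.1.toState.F :=
      (isPermissibleCentre_iff p row.1.2.1 row.1.1.L).mpr hS
    exact ⟨(BaseChange.isPermissibleCentre_map_iff f p row.1.2.1 _).mpr hperm,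
      sedges_of_move f hrest hall hflats hleaves hcov⟩
  rcases h with (hb | ht) | hm
  · -- a monomial-curve blindness certificate: blind over `K`; the second clause is vacuous
    have hsome : row.1.2.2 ≠ none := by
      unfold smonoBlindOK at hb
      obtain ⟨⟨s, S, oβ⟩, ws, fl, lv⟩ := row
      rcases oβ with _ | ⟨c, w, α₀, a⟩ | ⟨P, v, D, kk, α₀, a⟩
      · exact absurd hb Bool.false_ne_true
      · exact Option.some_ne_none _
      · exact Option.some_ne_none _
    refine ⟨?_, fun hnone => absurd hnone hsome⟩
    unfold smonoBlindOK at hb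
    obtain ⟨⟨s, S, oβ⟩, ws, fl, lv⟩ := row
    rcases oβ with _ | ⟨c, w, α₀, a⟩ | ⟨P, v, D, kk, α₀, a⟩
    · exact absurd hb Bool.false_ne_true
    · exact inScopeStateWins_of_not_inCoordinateScope (not_inCoordinateScope_map_of_blindB f hb)
    · exact absurd hb Bool.false_ne_true
  · -- origin not `p`-fold; the second clause is vacuous
    rw [Bool.not_eq_true'] at ht
    constructor
    · refine inScopeStateWins_of_no_permissible fun S hS => ?_
      exact no_permissible_of_not_permB ht S ((BaseChange.isPermissibleCentre_map_iff f p S _).mp hS)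
    · intro _ huniv
      rw [ht] at huniv
      exact absurd huniv Bool.false_ne_true
  · simp only [Bool.and_eq_true] at hm
    obtain ⟨⟨⟨⟨hS, hall⟩, hflats⟩, hleaves⟩, hcov⟩ := hm
    have hm' := hmove hS hall hflats hleaves hcov
    exact ⟨inScopeStateWins_move row.1.2.1 hm'.1 hm'.2, fun _ _ => hm'⟩

/-! ## 3. Soundness of a certificate over every field of characteristic `p` -/

/-- **SOUNDNESS OVER EVERY FIELD OF CHARACTERISTIC `p`**: every row of a checked certificate is good over `K`.
[folklore] -/
theorem srowGood_of_swinCertBL {p : ℕ} [Fact p.Prime] {K : Type} [Field K] [CharP K p] [DecidableEq K]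
    (f : ZMod p →+* K) : ∀ {T : SCert (ZMod p)}, swinCertBL p p T = true → ∀ row ∈ T, SRowGood f row
  | [], _ => fun row hrow => absurd hrow List.not_mem_nil
  | row :: rest, h => by
    unfold swinCertBL at h
    rw [Bool.and_eq_true] at h
    have hrest := srowGood_of_swinCertBL f h.2
    intro r hr
    rcases List.mem_cons.mp hr with rfl | hr'
    · exact srowGood_of_srowOK f hrest h.1
    · exact hrest r hr'

/-- **`∀ K` form**: for every field `K` of characteristic `p`, every row state `⊗ K` of a checked FCert-v2
certificate is IN-SCOPE ESCAPABLE (`InScopeStateWins p`: the F4-C game at `(p, p)`, player B ranging over ALL of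
`K⁴`). [folklore] -/
theorem forall_inScopeStateWins_of_swinCertBL {p : ℕ} [Fact p.Prime] {T : SCert (ZMod p)}
    (h : swinCertBL p p T = true) (K : Type) [Field K] [CharP K p] [DecidableEq K] :
    ∀ row ∈ T, InScopeStateWins p
      (⟨MvPolynomial.map (ZMod.castHom (dvd_refl p) K) row.1.1.toState.F, row.1.1.toState.r,
        row.1.1.toState.exc⟩ : State K) :=
  fun row hrow => (srowGood_of_swinCertBL (ZMod.castHom (dvd_refl p) K) h row hrow).1

end WinCertSubst

end Summit.ResolutionOfSingularities.ResolutionOfSingularities.Theorems.PIDim4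

end
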